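/-
Copyright (c) 2026. All rights reserved.
Released under Apache 2.0 license as described in the file LICENSE.
Authors: abc-iut cell, seat abc-iut-w4-d095 (gen 6; unblocking brick for the rows «PF-CARRIERS» (abc-iut-f-101) and
«PROP58-PF-VERTICES» (this seat), L4-lead m87/m88).
-/
import Literature.AnabelianGeometry.AbsoluteAnabelian.GaloisPadicLogMLF
import HarnessLib

/-!
# `G_k` acts FAITHFULLY on `k~ = 𝒪_k̄^×/μ` and on `k̄^×/μ`, for EVERY MLF closure datum `(k, k̄)`

S. Mochizuki, *Topics in absolute anabelian geometry III*, J. Math. Sci. Univ. Tokyo 22 (2015) [MochizukiAbsTopIII2015];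
manuscript `paper:url-5493eb38cbb7`, Def 3.1 (i) p. 66 (`k~ := (𝒪_k̄^×)^pf`, `log_k̄ : k~ ⥲ k̄`), Def 3.1 (ii) p. 67 ("of
mono-analytic type": the arithmetic Galois group of a pair `(Π ↷ M)` is the image of `Π` in `Aut M`), Prop 5.8 (ii) p. 139
(the perfection vertices `k~(G)`, `(k̄^×)^pf(G)` of `Γ⃗×_non(G)`).

PROOF-ONLY (no definition, no instance, no named fact).  In the cell's model categories a `TS`-pair records its
"arithmetic quotient" as `Π / Ker(Π → Aut M)` (abc-iut-L4-t9 `TSObj.actionKer`), and a morphism must respect these kernels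
(`TSObj.Hom.comap_ker`); so the vertical arrows `𝒪^×_k̄ → k~`, `k̄^× → (k̄^×)^pf` of `Γ⃗×_non` (identity on the Galois group)
are `TS`-morphisms ONLY IF `G_k` acts faithfully on the torsion quotients.  Over `ℚ̄_p` this is abc-iut-L4-t9's
`PadicAlgCl.algEquiv_eq_refl_of_forall_units` (p-adic analytic).  For an ARBITRARY `C : MLFClosure` — i.e. every object
of abc-iut-w6-d036's genuine mono-analytic base `MonoBase` — it is IMMEDIATE from abc-iut-L6-d2's `G_k`-EQUIVARIANT LOGARITHM
`GaloisPadicLog.logEquiv : 𝒪_k̄^×/μ ≃* (k̄, +)` (`toAdd_logEquiv_galois_symm`: `log_k̄ ∘ (σ · −) ∘ log_k̄⁻¹ = σ`): if `σ` fixes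
every class of `𝒪_k̄^×/μ` then `σ` fixes `log` of everything, i.e. all of `k̄`, so `σ = 1`.

* `GaloisPadicLog.apply_eq_self_of_forall_unitsModTorsionGaloisMap_eq` / `algEquiv_eq_one_of_…` — over any `(k, K)`
  carrying a `GaloisPadicLog` (abstract form);
* `unitsModTorsionGaloisMap_mk_eq_mk_iff` — `σ·[u] = [u]` in `𝒪_k̄^×/μ` iff `(σ u / u)^n = 1` for some `n ≥ 1`;
* (faithfulness of `G_k ↷ k~` in class form for `C : MLFClosure.{0}` = the abstract theorem at `C.galoisPadicLog`; its
  IUT-layer twin `AbsTopMonoids.Genuine.galois_eq_one_of_unitsModTorsionGaloisMap_eq` is not restated);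
* `MLFClosure.algEquiv_eq_one_of_forall_unitGroup_div_pow_eq_one` / `…_of_forall_units_div_pow_eq_one` — the same with the
  hypothesis "`σ u / u` is a root of unity for every unit `u ∈ 𝒪_k̄^×`" resp. "for every `u ∈ k̄^×`" (the general-`C` twin of
  `PadicAlgCl.algEquiv_eq_refl_of_forall_units`): **faithfulness of `G_k ↷ k̄^×/μ`**.

Classical; nothing here bears on [IUTchIII] Cor. 3.12; no side taken.
-/

set_option autoImplicit false

universe u

namespace Literature.AnabelianGeometry.AbsoluteAnabelian

open scoped ValuativeRel

variable {k : Type u} [Field k] [ValuativeRel k] {K : Type u} [Field K] [Algebra k K]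

/-! ## Abstract form: any `(k, K)` with a Galois-equivariant `p`-adic logarithm -/

namespace GaloisPadicLog

/-- If `σ ∈ Gal(k̄/k)` acts trivially on `k~ = 𝒪_k̄^×/μ`, then `σ` fixes every element of `k̄`
(`log_k̄ ∘ (σ·−) ∘ log_k̄⁻¹ = σ` and `log_k̄` is onto `k̄`). [cite: MochizukiAbsTopIII2015, Definition 3.1 (i) p.66] -/
theorem apply_eq_self_of_forall_unitsModTorsionGaloisMap_eq (L : GaloisPadicLog k K) (σ : K ≃ₐ[k] K)
    (h : ∀ x : unitGroup k K ⧸ CommGroup.torsion (unitGroup k K), unitsModTorsionGaloisMap σ x = x) (z : K) :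
    σ z = z := by
  rw [← L.toAdd_logEquiv_galois_symm σ z, h, MulEquiv.apply_symm_apply, toAdd_ofAdd]

/-- **Faithfulness of `G_k` on `k~ = 𝒪_k̄^×/μ`** (abstract form): `σ` acting trivially on `𝒪_k̄^×/μ` is the identity.
[cite: MochizukiAbsTopIII2015, Definition 3.1 (ii) p.67] -/
theorem algEquiv_eq_one_of_forall_unitsModTorsionGaloisMap_eq (L : GaloisPadicLog k K) (σ : K ≃ₐ[k] K)
    (h : ∀ x : unitGroup k K ⧸ CommGroup.torsion (unitGroup k K), unitsModTorsionGaloisMap σ x = x) : σ = 1 :=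
  AlgEquiv.ext (L.apply_eq_self_of_forall_unitsModTorsionGaloisMap_eq σ h)

end GaloisPadicLog

/-- `σ·[u] = [u]` in `𝒪_k̄^×/μ` iff `σ u / u` is a root of unity: `(σ u / u)^n = 1` for some `n ≥ 1`.
[cite: MochizukiAbsTopIII2015, Definition 3.1 (i) p.66] -/
theorem unitsModTorsionGaloisMap_mk_eq_mk_iff (σ : K ≃ₐ[k] K) (u : unitGroup k K) :
    unitsModTorsionGaloisMap σ (QuotientGroup.mk u) = QuotientGroup.mk u ↔
      ∃ n : ℕ, 0 < n ∧ (σ ((u : Kˣ) : K) / ((u : Kˣ) : K)) ^ n = 1 := by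
  rw [unitsModTorsionGaloisMap_mk, QuotientGroup.eq, CommGroup.mem_torsion, isOfFinOrder_unitGroup_iff]
  have hval : ((((unitGroupGaloisMap σ u)⁻¹ * u : unitGroup k K) : Kˣ) : K) =
      (σ ((u : Kˣ) : K))⁻¹ * ((u : Kˣ) : K) := by
    rw [Subgroup.coe_mul, Subgroup.coe_inv, Units.val_mul, Units.val_inv_eq_inv_val, unitGroupGaloisMap_coe]
  rw [hval]
  refine exists_congr fun n => and_congr_right fun _ => ?_
  rw [show (σ ((u : Kˣ) : K))⁻¹ * ((u : Kˣ) : K) = (σ ((u : Kˣ) : K) / ((u : Kˣ) : K))⁻¹ by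
    rw [div_eq_mul_inv, mul_inv, inv_inv], inv_pow, inv_eq_one]

namespace MLFClosure

variable (C : MLFClosure.{0})

/-- (Faithfulness of `G_k ↷ k~ = 𝒪_k̄^×/μ` for an `MLFClosure` in CLASS form is the abstract theorem above at
`C.galoisPadicLog`; at the IUT layer it is also abc-iut's `AbsTopMonoids.Genuine.galois_eq_one_of_unitsModTorsionGaloisMap_eq`
— not restated here.)  REPRESENTATIVE form: if `σ u / u` is a root of unity for every unit `u ∈ 𝒪_k̄^×`, then `σ = 1` —
the perfection vertex `k~(G)` of `Γ⃗×_non(G)` is of mono-analytic type. [cite: MochizukiAbsTopIII2015, Prop 5.8 (ii) p. 139] -/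
theorem algEquiv_eq_one_of_forall_unitGroup_div_pow_eq_one (σ : C.K ≃ₐ[C.k] C.K)
    (h : ∀ u : unitGroup C.k C.K, ∃ n : ℕ, 0 < n ∧ (σ ((u : (C.K)ˣ) : C.K) / ((u : (C.K)ˣ) : C.K)) ^ n = 1) :
    σ = 1 := by
  refine GaloisPadicLog.algEquiv_eq_one_of_forall_unitsModTorsionGaloisMap_eq C.galoisPadicLog σ fun x => ?_
  induction x using QuotientGroup.induction_on with
  | H u => exact (unitsModTorsionGaloisMap_mk_eq_mk_iff σ u).mpr (h u)

/-- **Faithfulness of `G_k ↷ (k̄^×)^pf = k̄^×/μ` for EVERY MLF closure datum** — the general-`C` twin of abc-iut-L4-t9's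
`PadicAlgCl.algEquiv_eq_refl_of_forall_units`: if `σ u / u` is a root of unity for every `u ∈ k̄^×`, then `σ = 1`.
[cite: MochizukiAbsTopIII2015, Prop 5.8 (ii) p. 139] -/
theorem algEquiv_eq_one_of_forall_units_div_pow_eq_one (σ : C.K ≃ₐ[C.k] C.K)
    (h : ∀ u : (C.K)ˣ, ∃ n : ℕ, 0 < n ∧ (σ (u : C.K) / (u : C.K)) ^ n = 1) : σ = 1 :=
  C.algEquiv_eq_one_of_forall_unitGroup_div_pow_eq_one σ fun u => h (u : (C.K)ˣ)

/-- The same in `AlgEquiv.refl` spelling (the shape of `PadicAlgCl.algEquiv_eq_refl_of_forall_units`).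
[cite: MochizukiAbsTopIII2015, Prop 5.8 (ii) p. 139] -/
theorem algEquiv_eq_refl_of_forall_units_div_pow_eq_one (σ : C.K ≃ₐ[C.k] C.K)
    (h : ∀ u : (C.K)ˣ, ∃ n : ℕ, 0 < n ∧ (σ (u : C.K) / (u : C.K)) ^ n = 1) : σ = AlgEquiv.refl :=
  C.algEquiv_eq_one_of_forall_units_div_pow_eq_one σ h

/-- Class form on `k̄^×/μ`: if `σ` fixes the class of every `u ∈ k̄^×` modulo the torsion of `k̄^×`, then `σ = 1`.
[cite: MochizukiAbsTopIII2015, Prop 5.8 (ii) p. 139] -/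
theorem algEquiv_eq_one_of_forall_unitsMap_mk_eq (σ : C.K ≃ₐ[C.k] C.K)
    (h : ∀ u : (C.K)ˣ, (QuotientGroup.mk (Units.map (σ : C.K →* C.K) u) : (C.K)ˣ ⧸ CommGroup.torsion (C.K)ˣ) =
      QuotientGroup.mk u) : σ = 1 := by
  refine C.algEquiv_eq_one_of_forall_units_div_pow_eq_one σ fun u => ?_
  have hu := h u
  rw [QuotientGroup.eq, CommGroup.mem_torsion, isOfFinOrder_iff_pow_eq_one] at hu
  obtain ⟨n, hn, hpow⟩ := hu
  refine ⟨n, hn, ?_⟩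
  have hval := congrArg (fun v : (C.K)ˣ => (v : C.K)) hpow
  simp only [Units.val_pow_eq_pow_val, Units.val_mul, Units.val_inv_eq_inv_val, Units.coe_map, MonoidHom.coe_coe,
    Units.val_one] at hval
  rw [show σ (u : C.K) / (u : C.K) = ((σ (u : C.K))⁻¹ * (u : C.K))⁻¹ by rw [mul_inv, inv_inv, div_eq_mul_inv],
    inv_pow, inv_eq_one]
  exact hval

end MLFClosure

end Literature.AnabelianGeometry.AbsoluteAnabelian
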